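import Summits.QuantumFields.YangMills.Theorems.BalabanLadderIROddTorusLargeFieldRarityRep
import Mathlib.MeasureTheory.Integral.MeanInequalities
import HarnessLib

/-!
# Hereditary large-field rarity on the ODD torus — SHARP rate (Hölder over the orientations instead of pigeonhole)

Support file (seat ym-infvol-p3, fleet R136 (i); crux `IR` = stmt-QuantumFields-19354, registered line «af-pincer-U»,
clause (iii) of `TypShellCondUKP`; count-neutral helper).

`…OddTorusLargeFieldRarity` bounds `μ_{L,β}{∀ i ∈ F, T ≤ ∑_{q ∈ P_i} φ_q}` by `(m · exp(-λT/m² + n Δ_Λ(λ)/(m L^d)))^{#F}`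
(`m` = number of orientations, `Δ_Λ(λ) = log Z_Λ(β-λ) - log Z_Λ(β)`), losing one factor `m` in the rate to a pigeonhole
over the orientations inside each cell and paying the prefactor `m^{#F}` for the union over assignments.  For the
excess-sparse factor of the IR line's working class the rate constant enters the class design (CONTAGION-NOTE-g6 §3.3:
«typicality `E₀ > 4 c_ξ / λ`» against «wire exclusion `E₀ < c_w t_w R₀³ / 2`»), so the factor `m` matters for the
admissible radius `R₀`.  This file proves the SHARP form by the generalized Hölder inequality over the `m` orientations
(Mathlib `ENNReal.lintegral_prod_norm_pow_le`) applied to `exp(c ∑_{q ∈ P} φ_q) = ∏_o exp(c ∑_{q ∈ P, q ∥ o} φ_q)`: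

* `wilsonExpectation_expObs_le_prod_rpow` — `⟨exp(c ∑_P φ)⟩ ≤ ∏_o ⟨exp(m c ∑_{P_o} φ)⟩^{1/m}` (`c ≥ 0`);
* `wilsonExpectation_expObs_le_exp_card_all` — for ANY finite plaquette set `P` (all orientations), `0 ≤ c`, `m c ≤ β`:
  `⟨exp(c ∑_{q ∈ P} φ_q)⟩_{Λ,β} ≤ exp((#P / (m L^d)) · Δ_Λ(m c))` (one-orientation chessboard per factor);
* **`measureReal_forall_le_cellAction_le_pow_sharp`** — `0 ≤ λ ≤ β`, pairwise disjoint cells with `≤ n` plaquettes: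
  `μ_{L,β}{∀ i ∈ F, T ≤ ∑_{q ∈ P_i} φ_q} ≤ (exp(-λT/m + n Δ_Λ(λ)/(m L^d)))^{#F}` — NO prefactor `m`, rate `λT/m`;
* **`measureReal_forall_le_cellAction_le_pow_rep_sharp`** — the volume-free form for a lattice representation
  (`d = 4`, `β ≥ 1`): `≤ (exp(-λT/m + n (K₀ + D₁ log β)/m))^{#F}`.

Everything here is proved (no `sorry`, no new axioms).  HONEST FRAMING: a finite-torus Peierls–chessboard constant;
nothing about decoupling, (i), the mass gap or Clay.  Refs: Fröhlich–Israel–Lieb–Simon, CMP 62 (1978) Thm. 4.1, §5.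
-/

noncomputable section

open MeasureTheory Finset
open scoped ENNReal
open Literature.MathematicalPhysics
open Literature.MathematicalPhysics.QuantumFieldTheory Literature.MathematicalPhysics.QuantumLattice
open Literature.MathematicalPhysics.QuantumFieldTheory.WilsonRP
open Summit.QuantumFields.YangMills.Theorems.SoloBlind
open Summit.QuantumFields.YangMills.Theorems.FreeEnergyLogCoefficient

namespace Summit.QuantumFields.YangMills.Theorems.OddTorusChessboard

section General

variable {d L N : ℕ} [NeZero d] [NeZero L] {G : Type*} [Group G] [TopologicalSpace G]
  [IsTopologicalGroup G] [CompactSpace G] [MeasurableSpace G] [BorelSpace G]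
  (ρ : G →* Matrix (Fin N) (Fin N) ℂ)

omit [NeZero d] [NeZero L] [TopologicalSpace G] [IsTopologicalGroup G] [CompactSpace G] [MeasurableSpace G]
  [BorelSpace G] in
/-- `exp(c ∑_{q ∈ P} φ_q) = ∏_o exp(c ∑_{q ∈ P, q ∥ o} φ_q)`. -/
theorem expObs_eq_prod_orient (c : ℝ) (P : Finset (Plaquette d L)) (U : GaugeConfig d L G) :
    expObs ρ c P U = ∏ o : Orient d, expObs ρ c (P.filter fun q => q.2 = o) U := by
  classical
  unfold expObs
  rw [← Real.exp_sum, ← Finset.mul_sum, Finset.sum_fiberwise]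

omit [NeZero d] [NeZero L] [TopologicalSpace G] [IsTopologicalGroup G] [CompactSpace G] [MeasurableSpace G]
  [BorelSpace G] in
/-- `exp(c S) = exp(m c S)^{1/m}`. -/
theorem expObs_eq_rpow (c : ℝ) {m : ℝ} (hm : m ≠ 0) (A : Finset (Plaquette d L)) (U : GaugeConfig d L G) :
    expObs ρ c A U = expObs ρ (m * c) A U ^ (1 / m) := by
  unfold expObs
  rw [← Real.exp_mul]
  congr 1
  field_simp

omit [NeZero d] in
/-- **Hölder over the orientations**: `⟨exp(c ∑_P φ)⟩ ≤ ∏_o ⟨exp(m c ∑_{P_o} φ)⟩^{1/m}`. -/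
theorem wilsonExpectation_expObs_le_prod_rpow (hρ : Continuous ρ) (β c : ℝ) (P : Finset (Plaquette d L))
    (hm : 0 < Fintype.card (Orient d)) :
    wilsonExpectation ρ β (expObs (G := G) ρ c P) ≤
      ∏ o : Orient d, wilsonExpectation ρ β
        (expObs (G := G) ρ (Fintype.card (Orient d) * c) (P.filter fun q => q.2 = o)) ^
          (1 / (Fintype.card (Orient d) : ℝ)) := by
  classical
  set m : ℕ := Fintype.card (Orient d) with hmdef
  have hm0 : (m : ℝ) ≠ 0 := by exact_mod_cast hm.ne'
  have hmpos : (0 : ℝ) < m := by exact_mod_cast hm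
  set μ := wilsonMeasure (d := d) (L := L) (G := G) ρ β with hμ
  haveI : IsProbabilityMeasure μ := isProbabilityMeasure_wilsonMeasure (d := d) (L := L) (G := G) ρ hρ β
  -- integrability of the exponential observables
  have hint : ∀ (c' : ℝ) (A : Finset (Plaquette d L)), Integrable (expObs (G := G) ρ c' A) μ := by
    intro c' A
    obtain ⟨C, hC⟩ := exists_abs_expObs_le ρ hρ c' A
    exact integrable_wilsonMeasure_of_abs_le ρ hρ β (measurable_expObs ρ hρ c' A) hC
  -- the factors
  set f : Orient d → GaugeConfig d L G → ℝ≥0∞ := fun o U =>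
    ENNReal.ofReal (expObs ρ (m * c) (P.filter fun q => q.2 = o) U) with hf
  have hfm : ∀ o ∈ (Finset.univ : Finset (Orient d)), AEMeasurable (f o) μ := fun o _ =>
    (measurable_expObs ρ hρ _ _).ennreal_ofReal.aemeasurable
  have hp : ∑ _o ∈ (Finset.univ : Finset (Orient d)), (1 / (m : ℝ)) = 1 := by
    rw [Finset.sum_const, Finset.card_univ, ← hmdef, nsmul_eq_mul]
    field_simp
  have hHolder := ENNReal.lintegral_prod_norm_pow_le (μ := μ) Finset.univ hfm hp fun _ _ => by positivity
  -- the integrand on the left is `ofReal (expObs c P)`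
  have hlhs : ∀ U, ∏ o ∈ (Finset.univ : Finset (Orient d)), f o U ^ (1 / (m : ℝ)) =
      ENNReal.ofReal (expObs ρ c P U) := by
    intro U
    rw [expObs_eq_prod_orient ρ c P U, ENNReal.ofReal_prod_of_nonneg fun o _ => (expObs_pos ρ _ _ U).le]
    refine Finset.prod_congr rfl fun o _ => ?_
    simp only [hf]
    rw [ENNReal.ofReal_rpow_of_nonneg (expObs_pos ρ _ _ U).le (by positivity),
      ← expObs_eq_rpow ρ c hm0]
  simp_rw [hlhs] at hHolder
  -- left: `ofReal ⟨expObs c P⟩`; right: `∏ ofReal ⟨expObs (m c) P_o⟩ ^ (1/m)`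
  have hL : ∫⁻ U, ENNReal.ofReal (expObs ρ c P U) ∂μ = ENNReal.ofReal (wilsonExpectation ρ β (expObs (G := G) ρ c P)) := by
    rw [wilsonExpectation, ← hμ, ofReal_integral_eq_lintegral_ofReal (hint c P) (ae_of_all _ fun U => (expObs_pos ρ c P U).le)]
  have hR : ∀ o, ∫⁻ U, f o U ∂μ =
      ENNReal.ofReal (wilsonExpectation ρ β (expObs (G := G) ρ (m * c) (P.filter fun q => q.2 = o))) := by
    intro o
    rw [hf, wilsonExpectation, ← hμ, ofReal_integral_eq_lintegral_ofReal (hint _ _)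
      (ae_of_all _ fun U => (expObs_pos ρ _ _ U).le)]
  rw [hL] at hHolder
  simp_rw [hR] at hHolder
  -- back to reals
  have hfin : ∏ o ∈ (Finset.univ : Finset (Orient d)),
      ENNReal.ofReal (wilsonExpectation ρ β (expObs (G := G) ρ (m * c) (P.filter fun q => q.2 = o))) ^
        (1 / (m : ℝ)) ≠ ∞ :=
    ENNReal.prod_ne_top fun o _ => ENNReal.rpow_ne_top_of_nonneg (by positivity) ENNReal.ofReal_ne_top
  have := (ENNReal.ofReal_le_iff_le_toReal hfin).1 hHolder
  refine this.trans (le_of_eq ?_)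
  rw [ENNReal.toReal_prod]
  refine Finset.prod_congr rfl fun o _ => ?_
  rw [← ENNReal.toReal_rpow, ENNReal.toReal_ofReal (wilsonExpectation_expObs_nonneg ρ β _ _)]

/-- **The chessboard estimate on the odd torus, ALL orientations, sharp rate**: for `L` odd, `L ≥ 3`, continuous `ρ`,
`0 ≤ c` with `m c ≤ β` and ANY finite set `P` of plaquettes,
`⟨exp(c ∑_{q ∈ P} φ_q)⟩_{Λ,β} ≤ exp((#P / (m L^d)) · (log Z_Λ(β - m c) - log Z_Λ(β)))`. -/
theorem wilsonExpectation_expObs_le_exp_card_all (hL : Odd L) (hL3 : 3 ≤ L) (hρ : Continuous ρ) {β c : ℝ}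
    (hc : 0 ≤ c) (hmc : (Fintype.card (Orient d) : ℝ) * c ≤ β) (hm : 0 < Fintype.card (Orient d))
    (P : Finset (Plaquette d L)) :
    wilsonExpectation ρ β (expObs (G := G) ρ c P) ≤
      Real.exp ((#P : ℝ) / ((Fintype.card (Orient d) : ℝ) * (L : ℝ) ^ d) *
        (torusLogPartition d ρ (β - Fintype.card (Orient d) * c) L - torusLogPartition d ρ β L)) := by
  classical
  set m : ℕ := Fintype.card (Orient d) with hmdef
  have hmpos : (0 : ℝ) < m := by exact_mod_cast hm
  set Δ : ℝ := torusLogPartition d ρ (β - m * c) L - torusLogPartition d ρ β L with hΔ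
  have hmc0 : 0 ≤ (m : ℝ) * c := by positivity
  refine (wilsonExpectation_expObs_le_prod_rpow ρ hρ β c P hm).trans ?_
  -- each factor: one-orientation chessboard at parameter `m c`
  have hfac : ∀ o : Orient d,
      wilsonExpectation ρ β (expObs (G := G) ρ (m * c) (P.filter fun q => q.2 = o)) ^ (1 / (m : ℝ)) ≤
        Real.exp ((#(P.filter fun q => q.2 = o) : ℝ) / ((m : ℝ) * (L : ℝ) ^ d) * Δ) := by
    intro o
    have h := wilsonExpectation_expObs_le_exp_card (d := d) (L := L) (G := G) ρ hL hL3 hρ hmc0 hmc o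
      (P.filter fun q => q.2 = o) fun q hq => (Finset.mem_filter.1 hq).2
    calc wilsonExpectation ρ β (expObs (G := G) ρ (m * c) (P.filter fun q => q.2 = o)) ^ (1 / (m : ℝ))
        ≤ Real.exp ((#(P.filter fun q => q.2 = o) : ℝ) / (L : ℝ) ^ d * Δ) ^ (1 / (m : ℝ)) :=
          Real.rpow_le_rpow (wilsonExpectation_expObs_nonneg ρ β _ _) h (by positivity)
      _ = Real.exp ((#(P.filter fun q => q.2 = o) : ℝ) / ((m : ℝ) * (L : ℝ) ^ d) * Δ) := by
          rw [← Real.exp_mul]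
          congr 1
          field_simp
  calc ∏ o : Orient d, wilsonExpectation ρ β (expObs (G := G) ρ (m * c) (P.filter fun q => q.2 = o)) ^ (1 / (m : ℝ))
      ≤ ∏ o : Orient d, Real.exp ((#(P.filter fun q => q.2 = o) : ℝ) / ((m : ℝ) * (L : ℝ) ^ d) * Δ) :=
        Finset.prod_le_prod (fun o _ => Real.rpow_nonneg (wilsonExpectation_expObs_nonneg ρ β _ _) _)
          fun o _ => hfac o
    _ = Real.exp ((#P : ℝ) / ((m : ℝ) * (L : ℝ) ^ d) * Δ) := by
        rw [← Real.exp_sum]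
        congr 1
        rw [← Finset.sum_mul, ← Finset.sum_div]
        congr 2
        rw [Finset.card_eq_sum_card_fiberwise (f := fun q : Plaquette d L => q.2) (t := Finset.univ)
          fun q _ => Finset.mem_coe.2 (Finset.mem_univ _)]
        push_cast
        rfl

/-- **Hereditary large-field rarity on the odd torus, SHARP rate.**  `L` odd, `L ≥ 3`, continuous `ρ`, `0 ≤ λ ≤ β`;
finitely many pairwise disjoint cells `P_i` with at most `n` plaquettes each (any orientations):
`μ_{L,β}{∀ i ∈ F, T ≤ ∑_{q ∈ P_i} φ_q} ≤ (exp(-λT/m + n Δ_Λ(λ)/(m L^d)))^{#F}`, `Δ_Λ(λ) = log Z_Λ(β-λ) - log Z_Λ(β)`. -/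
theorem measureReal_forall_le_cellAction_le_pow_sharp (hL : Odd L) (hL3 : 3 ≤ L) (hρ : Continuous ρ) {β lam : ℝ}
    (hlam : 0 ≤ lam) (hlamβ : lam ≤ β) {ι : Type*} (F : Finset ι) (P : ι → Finset (Plaquette d L))
    (hdisj : ∀ i ∈ F, ∀ j ∈ F, i ≠ j → Disjoint (P i) (P j)) {n : ℕ} (hn : ∀ i ∈ F, #(P i) ≤ n) (T : ℝ)
    (hm : 0 < Fintype.card (Orient d)) :
    (wilsonMeasure ρ β).real {U | ∀ i ∈ F, T ≤ ∑ q ∈ P i, plaquetteCost ρ U q} ≤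
      (Real.exp (-(lam * T) / Fintype.card (Orient d) +
        n * ((torusLogPartition d ρ (β - lam) L - torusLogPartition d ρ β L) / (L : ℝ) ^ d) /
          Fintype.card (Orient d))) ^ #F := by
  classical
  set m : ℕ := Fintype.card (Orient d) with hmdef
  have hmpos : (0 : ℝ) < m := by exact_mod_cast hm
  set c : ℝ := lam / m with hcdef
  have hc : 0 ≤ c := by positivity
  have hmc : (m : ℝ) * c = lam := by rw [hcdef]; field_simp
  set Q : Finset (Plaquette d L) := F.biUnion P with hQ
  set Δ : ℝ := torusLogPartition d ρ (β - lam) L - torusLogPartition d ρ β L with hΔ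
  have hΔ0 : 0 ≤ Δ := SoloBlind.torusLogPartition_sub_nonneg (d := d) (L := L) (G := G) ρ hρ hlam
  have hQcard : (#Q : ℝ) ≤ n * #F := by
    have h1 : #Q ≤ ∑ i ∈ F, #(P i) := Finset.card_biUnion_le
    have h2 : ∑ i ∈ F, #(P i) ≤ ∑ _i ∈ F, n := Finset.sum_le_sum fun i hi => hn i hi
    rw [Finset.sum_const, smul_eq_mul] at h2
    have : (#Q : ℝ) ≤ ((#F * n : ℕ) : ℝ) := by exact_mod_cast h1.trans h2
    rw [Nat.cast_mul] at this
    linarith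
  -- the event implies `c T #F ≤ c ∑_{q ∈ Q} φ_q`
  set X : GaugeConfig d L G → ℝ := fun U => c * ∑ q ∈ Q, plaquetteCost ρ U q with hX
  have hsub : {U : GaugeConfig d L G | ∀ i ∈ F, T ≤ ∑ q ∈ P i, plaquetteCost ρ U q} ⊆
      {U | c * (T * #F) ≤ X U} := by
    intro U hU
    simp only [Set.mem_setOf_eq] at hU ⊢
    rw [hX]
    refine mul_le_mul_of_nonneg_left ?_ hc
    rw [hQ, Finset.sum_biUnion hdisj]
    calc T * (#F : ℝ) = ∑ _i ∈ F, T := by rw [Finset.sum_const, nsmul_eq_mul, mul_comm]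
      _ ≤ ∑ i ∈ F, ∑ q ∈ P i, plaquetteCost ρ U q := Finset.sum_le_sum fun i hi => hU i hi
  have hXm : Measurable X :=
    (Finset.measurable_sum _ fun q _ => measurable_const.sub (measurable_plaqRe ρ hρ q)).const_mul _
  have hXb : ∀ U, |X U| ≤ |c| * (#Q * (2 * N)) := fun U => by
    rw [hX, abs_mul]
    refine mul_le_mul_of_nonneg_left ?_ (abs_nonneg _)
    calc |∑ q ∈ Q, plaquetteCost ρ U q| ≤ ∑ q ∈ Q, |plaquetteCost ρ U q| := Finset.abs_sum_le_sum_abs _ _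
      _ ≤ ∑ _q ∈ Q, (2 * (N : ℝ)) := Finset.sum_le_sum fun q _ => by
          have h := abs_plaqRe_le ρ hρ U q
          have hq : Literature.MathematicalPhysics.QuantumFieldTheory.plaquetteCost ρ U q = N - plaqRe ρ U q := rfl
          rw [hq]
          have := abs_le.1 h
          rw [abs_le]; constructor <;> linarith
      _ = #Q * (2 * N) := by rw [Finset.sum_const, nsmul_eq_mul]
  haveI := isProbabilityMeasure_wilsonMeasure (d := d) (L := L) (G := G) ρ hρ β
  have hcheb := measureReal_le_exp_neg_mul_wilsonExpectation_exp ρ hρ β hXm hXb (c * (T * #F))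
  have hexp : (fun U : GaugeConfig d L G => Real.exp (X U)) = expObs ρ c Q := by
    funext U; rfl
  rw [hexp] at hcheb
  have hmcβ : (Fintype.card (Orient d) : ℝ) * c ≤ β := by rw [← hmdef, hmc]; exact hlamβ
  have hchess := wilsonExpectation_expObs_le_exp_card_all (d := d) (L := L) (G := G) ρ hL hL3 hρ hc hmcβ hm Q
  rw [← hmdef, hmc, ← hΔ] at hchess
  calc (wilsonMeasure ρ β).real {U | ∀ i ∈ F, T ≤ ∑ q ∈ P i, plaquetteCost ρ U q}
      ≤ (wilsonMeasure ρ β).real {U | c * (T * #F) ≤ X U} := measureReal_mono hsub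
    _ ≤ Real.exp (-(c * (T * #F))) * wilsonExpectation ρ β (expObs (G := G) ρ c Q) := hcheb
    _ ≤ Real.exp (-(c * (T * #F))) * Real.exp ((#Q : ℝ) / ((m : ℝ) * (L : ℝ) ^ d) * Δ) :=
        mul_le_mul_of_nonneg_left hchess (Real.exp_pos _).le
    _ ≤ Real.exp (-(c * (T * #F))) * Real.exp ((n * #F : ℝ) / ((m : ℝ) * (L : ℝ) ^ d) * Δ) := by
        refine mul_le_mul_of_nonneg_left (Real.exp_le_exp.2 ?_) (Real.exp_pos _).le
        exact mul_le_mul_of_nonneg_right (div_le_div_of_nonneg_right hQcard (by positivity)) hΔ0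
    _ = (Real.exp (-(lam * T) / m + n * (Δ / (L : ℝ) ^ d) / m)) ^ #F := by
        rw [← Real.exp_add, ← Real.exp_nat_mul, hcdef]
        congr 1
        field_simp

end General

/-! ### The volume-free form for a lattice representation (`d = 4`) -/

section Rep

variable {G : Type} [Group G] [TopologicalSpace G] [IsTopologicalGroup G] [CompactSpace G]
  [MeasurableSpace G] [BorelSpace G]

/-- **Hereditary large-field rarity on odd four-tori, SHARP rate, volume-free base, every lattice representation.**
`∃ K₀ D₁, ∀ L odd ≥ 3, β ≥ 1, 0 ≤ λ ≤ β`, pairwise disjoint cells with at most `n` plaquettes each and every `T`,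
`μ_{L,β}{∀ i ∈ F, T ≤ ∑_{q ∈ P_i} φ_q} ≤ (exp(-λT/m + n (K₀ + D₁ log β)/m)) ^ #F` (`m = 6` orientations). -/
theorem measureReal_forall_le_cellAction_le_pow_rep_sharp (r : LatticeRep G) :
    ∃ K₀ : ℝ, ∃ D₁ : ℕ, ∀ {L : ℕ} [NeZero L], Odd L → 3 ≤ L → ∀ (β : ℝ), 1 ≤ β → ∀ (lam : ℝ), 0 ≤ lam → lam ≤ β →
      ∀ {ι : Type} (F : Finset ι) (P : ι → Finset (Plaquette 4 L)),
        (∀ i ∈ F, ∀ j ∈ F, i ≠ j → Disjoint (P i) (P j)) → ∀ (n : ℕ), (∀ i ∈ F, #(P i) ≤ n) → ∀ T : ℝ,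
          (wilsonMeasure (d := 4) (L := L) r.ρ β).real
              {U : GaugeConfig 4 L G | ∀ i ∈ F, T ≤ ∑ q ∈ P i, plaquetteCost r.ρ U q} ≤
            (Real.exp (-(lam * T) / Fintype.card (Orient 4) +
              n * (K₀ + D₁ * Real.log β) / Fintype.card (Orient 4))) ^ #F := by
  obtain ⟨C₁, hC₁, hΔ⟩ := torusLogPartition_sub_le_rep r
  refine ⟨48 - 4 * Real.log C₁, 2 * dimE r.ρ, ?_⟩
  intro L _ hL hL3 β hβ lam hlam hlamβ ι F P hdisj n hn T
  have hρc : Continuous r.ρ := r.continuous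
  set m : ℕ := Fintype.card (Orient 4) with hmdef
  have hm : 0 < Fintype.card (Orient 4) := Fintype.card_pos_iff.2 ⟨⟨((0 : Fin 4), (1 : Fin 4)), by decide⟩⟩
  have hm0 : (0 : ℝ) < m := by exact_mod_cast hm
  have h := measureReal_forall_le_cellAction_le_pow_sharp (d := 4) (L := L) r.ρ hL hL3 hρc hlam hlamβ F P hdisj hn T
    hm
  refine h.trans (pow_le_pow_left₀ (by positivity) ?_ _)
  refine Real.exp_le_exp.2 ?_
  have hL0 : (0 : ℝ) < (L : ℝ) ^ 4 := by
    have : (0 : ℝ) < L := by exact_mod_cast (show 0 < L by omega)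
    positivity
  have hdiv : (torusLogPartition 4 r.ρ (β - lam) L - torusLogPartition 4 r.ρ β L) / (L : ℝ) ^ 4 ≤
      48 - 4 * Real.log C₁ + ((2 * dimE r.ρ : ℕ) : ℝ) * Real.log β := by
    rw [div_le_iff₀ hL0]
    have := hΔ L β lam hβ hlam hlamβ
    push_cast
    linarith
  have hn0 : (0 : ℝ) ≤ n := Nat.cast_nonneg _
  have := mul_le_mul_of_nonneg_left hdiv hn0
  refine add_le_add le_rfl ?_
  exact div_le_div_of_nonneg_right this hm0.le

end Rep

end Summit.QuantumFields.YangMills.Theorems.OddTorusChessboard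

end
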